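import Summits.AtomisticToContinuum.FouriersLaw.Theses.OddSectorIrreversibility
import Summits.AtomisticToContinuum.FouriersLaw.Theorems.BondHeatUncertaintyExtensiveSnapshotIrreversibilityCorrectorIntegrability
import Summits.AtomisticToContinuum.FouriersLaw.Theorems.BondHeatUncertaintyLightConeBondHeatBondCorrelation
import Summits.AtomisticToContinuum.FouriersLaw.Theorems.OddSectorIrreversibilityOddDensityIsCorrectorResolvent
import Mathlib.MeasureTheory.Integral.IntegralEqImproper

/-!
# `CorrectorTheory` (stmt-AtomisticToContinuum-14071), part 1: existence of the Kubo corrector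

Helper file for support item `stmt-AtomisticToContinuum-14071`
(`OddSectorIrreversibility.CorrectorTheory`, conjunct A = the fixed-`N` corrector calculus).

For the pinned anharmonic chain `P = pinnedChain ω₂ lam β γ` (all parameters `> 0`), `N ≥ 1`,
both baths at temperature `T > 0`, equilibrium kernels `P_t = P.transitionKernel N T T t` and the
total current `J = ∑_i j_i`, the finite-horizon Kubo correctors
`u_τ(z) = ∫_{(0,τ]} P_t J(z) dt` converge, as `τ → ∞`, for EVERY `z` to the McLennan–Kubo corrector
`u⋆(z) = ∫_{(0,∞)} P_t J(z) dt`, with the exponential tail `|u_τ(z) - u⋆(z)| ≤ K e^{ϑH(z)} e^{-cτ}`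
(CEHR (2.5) in the `e^{ϑH}`-weighted norm, `2ϑ < 1/T`, and `μ_T(J) = 0` by momentum reversal);
hence `u⋆ ∈ L²(e^{-H/T} dx)`, `u_τ → u⋆` in `L²(e^{-H/T} dx)`, and the Dynkin split
`P_τ u⋆ = u⋆ - u_τ` (`corrector_exists`). Everything is assembled from proved tree theorems
(`pinnedChain_harris_bound`, `corrector_window_of_decay`); no named fact is used.

References: Cuneo–Eckmann–Hairer–Rey-Bellet 2018, Thm 2.13 (3) eq. (2.5); Kundu–Dhar–Narayan 2009
(the open-chain Kubo corrector). Nothing here closes the item.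
-/

noncomputable section

open MeasureTheory ProbabilityTheory Filter Topology Set Function
open scoped NNReal ENNReal
open Literature.MathematicalPhysics.KineticTheory.HeatConduction
open Summit.AtomisticToContinuum.FouriersLaw.Theorems.ExtensiveSnapshotIrreversibility.ClausiusBudget
open Summit.AtomisticToContinuum.FouriersLaw.Theorems.LightConeBondHeat

namespace Summit.AtomisticToContinuum.FouriersLaw.Theorems.OddSectorIrreversibility.Corrector

variable {N : ℕ}

/-! ### The total current: continuity, exponential class, zero Gibbs mean -/

/-- The total current `J = ∑_i j_i` of the pinned chain is continuous. [folklore] -/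
theorem continuous_totalBondCurrent (ω₂ lam β γ : ℝ) (N : ℕ) :
    Continuous fun z : PhaseSpace N => ∑ i : Fin N, (pinnedChain ω₂ lam β γ).bondCurrent N i z :=
  continuous_finsetSum _ fun i _ => pinnedChain_continuous_bondCurrent ω₂ lam β γ N i

/-- `|J| ≤ M e^{ϑH}` for every `ϑ > 0`, with an explicit `M = M_N(ϑ) ≥ 0`. [folklore] -/
theorem abs_totalBondCurrent_le_exp {ω₂ lam β : ℝ} (hω : 0 ≤ ω₂) (hl : 0 ≤ lam) (hβ : 0 ≤ β)
    (γ : ℝ) (N : ℕ) {ϑ : ℝ} (hϑ : 0 < ϑ) :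
    ∃ M : ℝ, 0 ≤ M ∧ ∀ y : PhaseSpace N,
      |∑ i : Fin N, (pinnedChain ω₂ lam β γ).bondCurrent N i y| ≤
        M * Real.exp (ϑ * (pinnedChain ω₂ lam β γ).hamiltonian N y) := by
  refine ⟨N * (N * ((3 + β) / 2) * (2 * Real.exp ϑ / ϑ ^ 2)), by positivity, fun y => ?_⟩
  calc |∑ i : Fin N, (pinnedChain ω₂ lam β γ).bondCurrent N i y|
      ≤ ∑ i : Fin N, |(pinnedChain ω₂ lam β γ).bondCurrent N i y| := Finset.abs_sum_le_sum_abs _ _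
    _ ≤ ∑ _i : Fin N, (N * ((3 + β) / 2) * (2 * Real.exp ϑ / ϑ ^ 2)) *
          Real.exp (ϑ * (pinnedChain ω₂ lam β γ).hamiltonian N y) :=
        Finset.sum_le_sum fun i _ => pinnedChain_abs_bondCurrent_le_exp hω hl hβ γ N hϑ i y
    _ = _ := by rw [Finset.sum_const, Finset.card_univ, Fintype.card_fin, nsmul_eq_mul]; ring

/-- The total current is odd in the momenta. [folklore] -/
theorem totalBondCurrent_neg_momentum (P : OscillatorChain) (N : ℕ) (x : PhaseSpace N) :
    (∑ i : Fin N, P.bondCurrent N i (x.1, -x.2)) = -∑ i : Fin N, P.bondCurrent N i x := by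
  rw [← Finset.sum_neg_distrib]
  exact Finset.sum_congr rfl fun i _ => OscillatorChain.bondCurrent_neg_momentum P N i x

/-- **Odd observables have zero Gibbs weight**: if `g(q,-p) = -g(q,p)` then `∫ g e^{-H/T} dq dp = 0`
for every oscillator chain (momentum reversal preserves Lebesgue measure and `H`; no integrability
needed, both sides being the same Bochner integral). [folklore] -/
theorem integral_mul_gibbsDensity_eq_zero_of_odd (P : OscillatorChain) (N : ℕ) (T : ℝ)
    {g : PhaseSpace N → ℝ} (hg : ∀ x, g (x.1, -x.2) = -g x) :
    ∫ x, g x * P.gibbsDensity N T x = 0 := by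
  have h := integral_comp_momentumReversal N fun x => g x * P.gibbsDensity N T x
  simp only [hg, OscillatorChain.gibbsDensity, OscillatorChain.hamiltonian_neg_momentum, neg_mul,
    integral_neg] at h
  simp only [OscillatorChain.gibbsDensity]
  linarith

/-- `μ_T(J) = 0`: the Gibbs mean of the total current vanishes (momentum reversal). [folklore] -/
theorem integral_totalBondCurrent_gibbsMeasure (ω₂ lam β γ : ℝ) (N : ℕ) (T : ℝ) :
    ∫ y, (∑ i : Fin N, (pinnedChain ω₂ lam β γ).bondCurrent N i y)
      ∂((pinnedChain ω₂ lam β γ).gibbsMeasure N T) = 0 := by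
  rw [(pinnedChain ω₂ lam β γ).integral_gibbsMeasure,
    integral_mul_gibbsDensity_eq_zero_of_odd _ N T (totalBondCurrent_neg_momentum _ N), mul_zero]


/-! ### The corrector -/

section Pinned

variable {ω₂ lam β γ : ℝ} (hω : 0 < ω₂) (hl : 0 < lam) (hβ : 0 < β) (hγ : 0 < γ) {T : ℝ} (hT : 0 < T)
  (hN : 0 < N)
include hω hl hβ hγ hT hN

/-- **Exponential decay of the evolved total current**: for `0 < ϑ < 1/T` there are `M ≥ 0`,
`C, c > 0` with `|J| ≤ M e^{ϑH}` and `|P_t J(z)| ≤ M C e^{ϑH(z)} e^{-ct}` (CEHR (2.5) at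
equilibrium and `μ_T(J) = 0`). [cite: CuneoEckmannHairerReyBellet2018, Thm 2.13 eq. (2.5)] -/
theorem totalBondCurrent_decay {ϑ : ℝ} (hϑ : 0 < ϑ) (hϑT : ϑ < 1 / T) :
    ∃ M C c : ℝ, 0 ≤ M ∧ 0 < C ∧ 0 < c ∧
      (∀ y : PhaseSpace N, |∑ i : Fin N, (pinnedChain ω₂ lam β γ).bondCurrent N i y| ≤
        M * Real.exp (ϑ * (pinnedChain ω₂ lam β γ).hamiltonian N y)) ∧
      ∀ (z : PhaseSpace N) (t : ℝ≥0),
        |∫ y, (∑ i : Fin N, (pinnedChain ω₂ lam β γ).bondCurrent N i y)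
            ∂((pinnedChain ω₂ lam β γ).transitionKernel N T T t z)| ≤
          M * C * Real.exp (ϑ * (pinnedChain ω₂ lam β γ).hamiltonian N z) * Real.exp (-c * t) := by
  obtain ⟨M, hM, hJM⟩ := abs_totalBondCurrent_le_exp hω.le hl.le hβ.le γ N hϑ
  obtain ⟨K, c, hK, hc, hb⟩ := pinnedChain_harris_bound hω hl.le hβ hγ hN hT hϑ hϑT
  refine ⟨M, K, c, hM, hK, hc, hJM, fun z t => ?_⟩
  have h := hb z t _ (continuous_totalBondCurrent ω₂ lam β γ N) M hM hJM
  rw [integral_totalBondCurrent_gibbsMeasure, sub_zero] at h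
  calc _ ≤ K * M * Real.exp (ϑ * (pinnedChain ω₂ lam β γ).hamiltonian N z) * Real.exp (-c * t) := h
    _ = _ := by ring

omit hγ hN in
/-- The unnormalised Gibbs weight `e^{-H/T} dx` is `Z • μ_T` (`Z` the partition function).
[folklore] -/
theorem withDensity_eq_smul_gibbsMeasure :
    (volume : Measure (PhaseSpace N)).withDensity
        (fun x => ENNReal.ofReal (Real.exp (-((pinnedChain ω₂ lam β γ).hamiltonian N x) / T))) =
      (pinnedChain ω₂ lam β γ).partitionFunction N T • (pinnedChain ω₂ lam β γ).gibbsMeasure N T := by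
  set P := pinnedChain ω₂ lam β γ with hP
  have hint : Integrable (P.gibbsDensity N T) := pinnedChain_integrable_gibbsDensity hω hl.le hβ.le γ N hT
  have hρc : Continuous (P.gibbsDensity N T) := pinnedChain_continuous_gibbsDensity ω₂ lam β γ N T
  rw [P.gibbsMeasure_eq_smul_withDensity hint, smul_smul,
    ENNReal.mul_inv_cancel (P.partitionFunction_ne_zero hρc) (P.partitionFunction_ne_top hint), one_smul]
  rfl

/-- **Existence of the Kubo corrector (fixed `N`).** For the pinned chain at equilibrium
temperature `T`, kernels `P_t`, total current `J`, `Pg s z = P_{s⁺}J(z)`,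
`u⋆ z = ∫_{(0,∞)} Pg s z ds`, and `0 < ϑ` with `2ϑ < 1/T`: there are `K ≥ 0`, `c > 0` such that
the time integral converges absolutely for every `z`, `u⋆` is strongly measurable with
`|u⋆| ≤ K e^{ϑH}`, the finite-horizon correctors `u_τ(z) = ∫_{(0,τ]} Pg s z ds` satisfy
`|u_τ(z) - u⋆(z)| ≤ K e^{ϑH(z)} e^{-cτ}` (so `u_τ → u⋆` pointwise everywhere), `u⋆ ∈ L²(e^{-H/T}dx)`,
`∫ (u_τ - u⋆)² e^{-H/T} dx → 0`, and the Dynkin split `P_τ u⋆ = u⋆ - u_τ` holds pointwise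
(`τ ≥ 0`). [cite: CuneoEckmannHairerReyBellet2018, Thm 2.13 eq. (2.5)] -/
theorem corrector_exists {ϑ : ℝ} (hϑ : 0 < ϑ) (h2ϑ : 2 * ϑ < 1 / T)
    (Pg : ℝ → PhaseSpace N → ℝ)
    (hPg : Pg = fun s z => ∫ y, (∑ i : Fin N, (pinnedChain ω₂ lam β γ).bondCurrent N i y)
      ∂((pinnedChain ω₂ lam β γ).transitionKernel N T T s.toNNReal z))
    (w : PhaseSpace N → ℝ) (hw : w = fun z => ∫ s in Set.Ioi (0 : ℝ), Pg s z) :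
    ∃ K c : ℝ, 0 ≤ K ∧ 0 < c ∧
      (∀ z : PhaseSpace N, IntegrableOn (fun s => Pg s z) (Set.Ioi (0 : ℝ))) ∧
      StronglyMeasurable w ∧
      (∀ z : PhaseSpace N, |w z| ≤ K * Real.exp (ϑ * (pinnedChain ω₂ lam β γ).hamiltonian N z)) ∧
      (∀ (z : PhaseSpace N) (τ : ℝ), 0 ≤ τ →
        |(∫ s in Set.Ioc (0 : ℝ) τ, Pg s z) - w z| ≤
          K * Real.exp (ϑ * (pinnedChain ω₂ lam β γ).hamiltonian N z) * Real.exp (-c * τ)) ∧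
      (∀ z : PhaseSpace N,
        Tendsto (fun τ : ℝ => ∫ s in Set.Ioc (0 : ℝ) τ, Pg s z) atTop (𝓝 (w z))) ∧
      MemLp w 2 ((volume : Measure (PhaseSpace N)).withDensity
        (fun x => ENNReal.ofReal (Real.exp (-((pinnedChain ω₂ lam β γ).hamiltonian N x) / T)))) ∧
      Tendsto (fun τ : ℝ => ∫ z, ((∫ s in Set.Ioc (0 : ℝ) τ, Pg s z) - w z) ^ 2
        ∂((volume : Measure (PhaseSpace N)).withDensity
          (fun x => ENNReal.ofReal (Real.exp (-((pinnedChain ω₂ lam β γ).hamiltonian N x) / T)))))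
        atTop (𝓝 0) ∧
      (∀ τ : ℝ, 0 ≤ τ → ∀ z : PhaseSpace N,
        ∫ x, w x ∂((pinnedChain ω₂ lam β γ).transitionKernel N T T τ.toNNReal z) =
          w z - ∫ s in Set.Ioc (0 : ℝ) τ, Pg s z) := by
  set P := pinnedChain ω₂ lam β γ with hP
  set H := P.hamiltonian N with hH
  set κ := P.transitionKernel N T T with hκ
  set μρ : Measure (PhaseSpace N) := (volume : Measure (PhaseSpace N)).withDensity
    (fun x => ENNReal.ofReal (Real.exp (-(H x) / T))) with hμρ
  have hϑT : ϑ < 1 / T := by linarith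
  obtain ⟨M, C, c, hM, hC, hc, hJM, hdecay⟩ := totalBondCurrent_decay hω hl hβ hγ hT hN hϑ hϑT
  -- the window package of the tree
  obtain ⟨hA, hwL2, hwin⟩ := corrector_window_of_decay hω hl hβ hγ hT hN hϑ h2ϑ hM hC.le hc
    (continuous_totalBondCurrent ω₂ lam β γ N) hJM hdecay Pg hPg
    (fun τ z => ∫ s in (0 : ℝ)..τ, Pg s z) rfl w hw
    (fun τ z => ∫ x, w x ∂(κ τ.toNNReal z)) rfl
  have hPg_apply : ∀ s z, Pg s z = ∫ y, (∑ i : Fin N, P.bondCurrent N i y) ∂(κ s.toNNReal z) :=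
    fun s z => by rw [hPg]
  have hw_apply : ∀ z, w z = ∫ s in Ioi (0 : ℝ), Pg s z := fun z => by rw [hw]
  -- pointwise decay of `Pg`
  have hPgb : ∀ (s : ℝ) (z : PhaseSpace N),
      |Pg s z| ≤ M * C * Real.exp (ϑ * H z) * Real.exp (-c * s) := by
    intro s z
    rw [hPg_apply]
    refine (hdecay z s.toNNReal).trans ?_
    refine mul_le_mul_of_nonneg_left (Real.exp_le_exp.2 ?_) (by positivity)
    have : s ≤ (s.toNNReal : ℝ) := Real.le_coe_toNNReal s
    nlinarith
  have hbound : ∀ z s, ‖Pg s z‖ ≤ M * C * Real.exp (ϑ * H z) * Real.exp (-c * s) := fun z s => by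
    rw [Real.norm_eq_abs]; exact hPgb s z
  have hmaj : ∀ (z : PhaseSpace N) (a : ℝ),
      IntegrableOn (fun s => M * C * Real.exp (ϑ * H z) * Real.exp (-c * s)) (Ioi a) :=
    fun z a => (exp_neg_integrableOn_Ioi a hc).const_mul _
  have hexpI : ∀ a : ℝ, ∫ s in Ioi a, Real.exp (-c * s) = Real.exp (-c * a) / c := by
    intro a
    rw [integral_exp_mul_Ioi (neg_lt_zero.2 hc) a, neg_div_neg_eq]
  -- joint measurability and measurability of `w`
  set S := pinnedChainSemigroup hω hl.le hβ.le hγ.le hN hT.le hT.le with hS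
  have hSM : StronglyMeasurable (Function.uncurry Pg) := by
    have h := (S.stronglyMeasurable_uncurry_act
      (continuous_totalBondCurrent ω₂ lam β γ N).stronglyMeasurable).comp_measurable measurable_swap
    rw [hPg]
    exact h
  have hwSM : StronglyMeasurable w := by
    rw [hw]
    exact hSM.integral_prod_left
  -- the constant
  set K : ℝ := M * C / c with hK
  have hK0 : 0 ≤ K := by positivity
  -- sup bound of `w`
  have hKw : ∀ z, |w z| ≤ K * Real.exp (ϑ * H z) := by
    intro z
    rw [hw_apply, ← Real.norm_eq_abs]
    calc ‖∫ s in Ioi (0 : ℝ), Pg s z‖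
        ≤ ∫ s in Ioi (0 : ℝ), M * C * Real.exp (ϑ * H z) * Real.exp (-c * s) :=
          norm_integral_le_of_norm_le (hmaj z 0) (Eventually.of_forall (hbound z))
      _ = K * Real.exp (ϑ * H z) := by
          rw [integral_const_mul, hexpI, mul_zero, Real.exp_zero, hK]; ring
  -- tail bound
  have htail : ∀ (z : PhaseSpace N) (τ : ℝ), 0 ≤ τ →
      |(∫ s in Ioc (0 : ℝ) τ, Pg s z) - w z| ≤ K * Real.exp (ϑ * H z) * Real.exp (-c * τ) := by
    intro z τ hτ
    have hsplit : ∫ s in Ioi (0 : ℝ), Pg s z = (∫ s in Ioc (0 : ℝ) τ, Pg s z) + ∫ s in Ioi τ, Pg s z := by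
      rw [← intervalIntegral.integral_of_le hτ]
      exact (intervalIntegral.integral_interval_add_Ioi (hA z) ((hA z).mono_set (Ioi_subset_Ioi hτ))).symm
    rw [hw_apply, hsplit, sub_add_cancel_left, abs_neg, ← Real.norm_eq_abs]
    calc ‖∫ s in Ioi τ, Pg s z‖
        ≤ ∫ s in Ioi τ, M * C * Real.exp (ϑ * H z) * Real.exp (-c * s) :=
          norm_integral_le_of_norm_le (hmaj z τ) (Eventually.of_forall (hbound z))
      _ = K * Real.exp (ϑ * H z) * Real.exp (-c * τ) := by
          rw [integral_const_mul, hexpI, hK]; ring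
  -- pointwise convergence
  have hptw : ∀ z : PhaseSpace N,
      Tendsto (fun τ : ℝ => ∫ s in Ioc (0 : ℝ) τ, Pg s z) atTop (𝓝 (w z)) := by
    intro z
    have h := intervalIntegral_tendsto_integral_Ioi 0 (hA z) tendsto_id
    rw [← hw_apply] at h
    refine h.congr' ?_
    filter_upwards [eventually_ge_atTop (0 : ℝ)] with τ hτ
    exact intervalIntegral.integral_of_le hτ
  -- the unnormalised weight is `Z • μ_T`
  have hZ : μρ = P.partitionFunction N T • P.gibbsMeasure N T :=
    withDensity_eq_smul_gibbsMeasure hω hl hβ hT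
  have hint : Integrable (P.gibbsDensity N T) := pinnedChain_integrable_gibbsDensity hω hl.le hβ.le γ N hT
  have hZtop : P.partitionFunction N T ≠ ⊤ := P.partitionFunction_ne_top hint
  have hwL2ρ : MemLp w 2 μρ := by
    rw [hZ]
    exact hwL2.smul_measure hZtop
  -- `L²` convergence
  have hexp2 : Integrable (fun z => Real.exp (2 * ϑ * H z)) (P.gibbsMeasure N T) :=
    pinnedChain_integrable_exp_mul_hamiltonian_gibbsMeasure hω hl.le hβ.le γ N hT h2ϑ
  set I₂ : ℝ := ∫ z, Real.exp (2 * ϑ * H z) ∂μρ with hI₂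
  have hexp2ρ : Integrable (fun z => Real.exp (2 * ϑ * H z)) μρ := by
    rw [hZ]; exact hexp2.smul_measure hZtop
  have hL2conv : Tendsto (fun τ : ℝ => ∫ z, ((∫ s in Ioc (0 : ℝ) τ, Pg s z) - w z) ^ 2 ∂μρ)
      atTop (𝓝 0) := by
    have hup : Tendsto (fun τ : ℝ => (K * Real.exp (-c * τ)) ^ 2 * I₂) atTop (𝓝 0) := by
      have h1 : Tendsto (fun τ : ℝ => Real.exp (-c * τ)) atTop (𝓝 0) := by
        have := Real.tendsto_exp_neg_atTop_nhds_zero.comp (tendsto_id.const_mul_atTop hc)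
        refine this.congr fun τ => ?_
        simp [neg_mul]
      have h2 : Tendsto (fun τ : ℝ => (K * Real.exp (-c * τ)) ^ 2 * I₂) atTop (𝓝 ((K * 0) ^ 2 * I₂)) :=
        ((h1.const_mul K).pow 2).mul_const I₂
      simpa using h2
    refine tendsto_of_tendsto_of_tendsto_of_le_of_le' tendsto_const_nhds hup
      (Eventually.of_forall fun τ => integral_nonneg fun z => sq_nonneg _) ?_
    filter_upwards [eventually_ge_atTop (0 : ℝ)] with τ hτ
    calc ∫ z, ((∫ s in Ioc (0 : ℝ) τ, Pg s z) - w z) ^ 2 ∂μρ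
        ≤ ∫ z, (K * Real.exp (-c * τ)) ^ 2 * Real.exp (2 * ϑ * H z) ∂μρ := by
          refine integral_mono_of_nonneg (Eventually.of_forall fun z => sq_nonneg _)
            (hexp2ρ.const_mul _) (Eventually.of_forall fun z => ?_)
          have h := htail z τ hτ
          have habs : |(∫ s in Ioc (0 : ℝ) τ, Pg s z) - w z| ≤
              (K * Real.exp (-c * τ)) * Real.exp (ϑ * H z) := by
            calc _ ≤ K * Real.exp (ϑ * H z) * Real.exp (-c * τ) := h
              _ = (K * Real.exp (-c * τ)) * Real.exp (ϑ * H z) := by ring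
          have hsq := sq_le_sq' (abs_le.1 habs).1 (abs_le.1 habs).2
          calc ((∫ s in Ioc (0 : ℝ) τ, Pg s z) - w z) ^ 2
              ≤ ((K * Real.exp (-c * τ)) * Real.exp (ϑ * H z)) ^ 2 := hsq
            _ = (K * Real.exp (-c * τ)) ^ 2 * Real.exp (2 * ϑ * H z) := by
                rw [mul_pow, sq (Real.exp (ϑ * H z)), ← Real.exp_add]; ring_nf
      _ = (K * Real.exp (-c * τ)) ^ 2 * I₂ := by rw [integral_const_mul]
  -- the Dynkin split
  have hsplit : ∀ τ : ℝ, 0 ≤ τ → ∀ z : PhaseSpace N,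
      ∫ x, w x ∂(κ τ.toNNReal z) = w z - ∫ s in Ioc (0 : ℝ) τ, Pg s z := by
    intro τ hτ z
    obtain ⟨-, -, hid⟩ := hwin τ hτ
    have h := hid z
    rw [intervalIntegral.integral_of_le hτ] at h
    change w z = (∫ s in Ioc (0 : ℝ) τ, Pg s z) + ∫ x, w x ∂(κ τ.toNNReal z) at h
    linarith
  exact ⟨K, c, hK0, hc, hA, hwSM, hKw, htail, hptw, hwL2ρ, hL2conv, hsplit⟩

end Pinned

end Summit.AtomisticToContinuum.FouriersLaw.Theorems.OddSectorIrreversibility.Corrector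

end
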